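import Summits.CriticalPhenomena.PercolationContinuityZ3.Theorems.PercNearOneGluingNoHeavyQuantTLBClosureHeavy
import Summits.CriticalPhenomena.PercolationContinuityZ3.Theorems.PercNearOneGluingNoHeavyQuantHeavyNodeRows
import Summits.CriticalPhenomena.PercolationContinuityZ3.Theorems.PercNearOneGluingNoHeavyQuantTwoLayerHalfFree
import HarnessLib

/-!
# QUANT lane: THE HEAVY NODE `TLBGateConvClosedHeavy` AND `FarTreeRowHeavy` ARE THEOREMS — final assembly via the FREE Theorem A
# (file when the three imports are in the tree: ⧗ p376241 `…QuantTLBClosureHeavy` (lead g37), ⧗ p378209 `…QuantHeavyNodeRows` (arm-1 g42),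
# ⧗ p378319 `…QuantTwoLayerHalfFree` (arm-3 g168); NOT needed on this route: p375979 `…TwoLayerHalf`, p378148 `…TwoLayerFreeTarget`, `…PushDown`)

builds on p205010 (kernel theorem, internal audit signed; external expert review pending)

Support file (`--supports stmt-CriticalPhenomena-4575 --as helper`), QUANT lane seat prim-quant-arm-3 (gen 168); a variant of prim-quant-arm-1 g42's
planned `…QuantHeavyNodeByName` with the free Theorem A (`tlb_lconv_freeThmA`, arm-3 g168) in place of 'mean-tied Theorem A (arm-2 g38) ⟶ free targets
≤ means by push-down (arm-1 g42)'.  Chain: free Theorem A ⟶ every row of the gated heavy node (`gateConv_tlbRows_of_freeThmA`, arm-1 g42, using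
arm-3 g165's `gateConv_row_belowTargets` below the small target and arm-1 g42's ♯ removal above it) ⟶ `TLBGateConvClosedHeavy` (lead g37) ⟶
`FarTreeRowHeavy` (`farTreeRowHeavy_of_tlbGateConvClosedHeavy`, lead g37): FAR on every rooted weighted forest whose relay marginals exceed `1/2`.
Verified in the SDEC-only combined scratch `run/shared/lean/prim/quant/prim-quant-arm-3-g168/lean/Scratch_HeavyNode_viaFree.lean` (farm rc 0, 0 warnings,
0 sorries; `#print axioms tlbGateConvClosedHeavy_holds` = propext, Classical.choice, Quot.sound) with the defs `TLB` / `TLBGateConvClosedHeavy` copied verbatim.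
ONLY ONE of this file and arm-1's `…QuantHeavyNodeByName` may land (same declaration names) — whichever route's imports are in the tree first.

FILE OF RECORD by lead g38's RULING V373 (quant INBOX l.1436, 2026-08-24T12:41Z); filing trigger: p376241 ∧ p378209 ∧ p378319 ACCEPTED.
CREDITS.  prim-quant-arm-3 g165 (rows `k < q·min Tᵢ`: `gateConv_row_belowTargets`, two-level tilt certificate) and g168 (free-form Theorem A
`tlb_lconv_freeThmA`, this assembly); prim-quant-arm-1 g42 (THEOREM ♯ / ♯1: `gateConv_row_of_sharp`, `gateConv_tlbRows_of_freeThmA`, the paper proof of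
the node); prim-quant-arm-2 g38 (THEOREM A, the certificate S* and the tensor-certificate principle: `halfCert_pointwise`, `halfRows_*`, `need_*`,
`twoLayer_pair_of_certificate`); prim-quant-stmt (typer) g34 (the q-free principle and the independent regime-M/R route `…QuantHeavyRegimeM/R`);
prim-quant-lead g37 (the node `TLBGateConvClosedHeavy`, `InvH`, and the reduction `farTreeRowHeavy_of_tlbGateConvClosedHeavy`) and g38 (rulings V369–V373);
countersigns: prim-quant-census-2 g63–g65 (exact adversarial engines, > 2.1 M product rows) and ARM-REF (prim-quant-arm-4) g108–g114.

[this work].  The rows served belong to the gluing programme of [cite: KozmaNitzan2024, Conjecture 3 (p. 15)].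
-/

noncomputable section

namespace Summit.CriticalPhenomena.PercolationContinuityZ3.Theorems

namespace Quant

namespace LawDec

/-- **THE HEAVY NODE HOLDS**: at floor `y ≥ 1/2` the gated two-layer family is closed under one-gate convolution (`TLBGateConvClosedHeavy`). [this work] -/
theorem tlbGateConvClosedHeavy_holds : TLBGateConvClosedHeavy := by
  intro y q M₁ M₂ μ₁ μ₂ hy hy1 hq0 hq1 n1 z1 s1 t1 n2 z2 s2 t2 c1 c2 d hd
  exact gateConv_tlbRows_of_freeThmA tlb_lconv_freeThmA y q M₁ M₂ μ₁ μ₂ hy hy1 hq0 hq1 n1 z1 s1 t1 n2 z2 s2 t2 c1 c2 d hd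

end LawDec

/-- **FAR ON HEAVY FORESTS**: the far-relay row on every rooted weighted forest whose relay marginals exceed `1/2`. [this work] -/
theorem farTreeRowHeavy_holds : FarTreeRowHeavy :=
  farTreeRowHeavy_of_tlbGateConvClosedHeavy LawDec.tlbGateConvClosedHeavy_holds

end Quant

end Summit.CriticalPhenomena.PercolationContinuityZ3.Theorems
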